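import Mathlib.LinearAlgebra.Complex.FiniteDimensional
import Mathlib.LinearAlgebra.Complex.Module
import Mathlib.FieldTheory.SeparableDegree
import Literature.AlgebraicGeometry.Frobenioids.ArchimedeanBaseCategory
import Literature.AlgebraicGeometry.Frobenioids.FiniteEtaleBase
import HarnessLib

/-!
# Frobenioids II, §3: comparison of the skeletal base `ArchFrd.D0` with `ArchBase = FinEtale ℝ`

Mochizuki, *The geometry of Frobenioids II: poly-Frobenioids*, Kyushu J. Math. **62** (2008)
401–460, §3 p. 23 [cite: MochizukiFrdII2008, §3 p.23]: `D₀` = connected finite étale coverings of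
`Spec ℝ`.

The tree carries two renderings of `D₀`: the non-skeletal `ArchBase := FinEtale ℝ` (all finite
separable extensions `K/ℝ`, Spec-direction algebra maps; `FiniteEtaleBase.lean`, abc-iut-L1-t4, over
which Definition 3.1 (v) `RC.*` is typed) and the two-object skeleton `ArchFrd.D0`
(`ArchimedeanBaseCategory.lean`, over which Example 3.3's `C₀` is constructed). This file is the
comparison functor requested by RULING W2-3 (2): `ArchFrd.D0.toArchBase : D0 ⥤ ArchBase`,
`real ↦ Spec ℝ`, `complex ↦ Spec ℂ`, `gal true ↦ (complex conjugation)`, `toRealHom ↦ (ℝ → ℂ)`, with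
the compatibility of the real / complex predicates (PROVED: `[ℝ:ℝ] = 1`, `[ℂ:ℝ] = 2`). Through it,
t4's `RC.IsComplexifiable`, `RC.IsRCConnected`, `RC.IsOfRCIsoSubanchorType`, … apply to any category
over the skeleton, `π : D ⥤ ArchFrd.D0`, as `RC.… (π ⋙ ArchFrd.D0.toArchBase)`.

**Claims.** Functoriality PROVED; `IsReal`/`IsComplex` compatibility PROVED; the functor is
faithful (PROVED). That it is an EQUIVALENCE ("every finite extension of `ℝ` is `ℝ` or `ℂ`" + full)
is recorded as the named statement `ArchFrd.D0.ToArchBaseIsEquivalence` (not proved here; pool item).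
-/

namespace Literature.AlgebraicGeometry.Frobenioids

open CategoryTheory

noncomputable section

namespace ArchFrd

namespace D0

/-- `Spec ℝ` as an object of `ArchBase = FinEtale ℝ`. [cite: MochizukiFrdII2008, §3 p.23] -/
def specReal : ArchBase := FinEtale.mk ℝ

/-- `Spec ℂ` as an object of `ArchBase = FinEtale ℝ`. [cite: MochizukiFrdII2008, §3 p.23] -/
def specComplex : ArchBase := FinEtale.mk ℂ

/-- The comparison functor on objects: `real ↦ Spec ℝ`, `complex ↦ Spec ℂ`.
[cite: MochizukiFrdII2008, §3 p.23] -/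
def toArchBaseObj : D0 → ArchBase
  | .real => specReal
  | .complex => specComplex

/-- The `ℝ`-algebra endomorphism of `ℂ` attached to a Boolean twist: identity or complex conjugation.
[cite: MochizukiFrdII2008, Def 3.1 (i) p.23] -/
def galAlgHom (σ : Bool) : ℂ →ₐ[ℝ] ℂ := bif σ then (Complex.conjAe : ℂ →ₐ[ℝ] ℂ) else AlgHom.id ℝ ℂ

/-- The trivial twist is the identity. [cite: MochizukiFrdII2008, Def 3.1 (i) p.23] -/
@[simp] theorem galAlgHom_false : galAlgHom false = AlgHom.id ℝ ℂ := rfl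

/-- The nontrivial twist is complex conjugation. [cite: MochizukiFrdII2008, Def 3.1 (i) p.23] -/
@[simp] theorem galAlgHom_true : galAlgHom true = (Complex.conjAe : ℂ →ₐ[ℝ] ℂ) := rfl

/-- On elements, `galAlgHom σ` agrees with the twist `galAct σ` of `ArchimedeanBaseCategory.lean`
(identity or `conj`). [cite: MochizukiFrdII2008, Def 3.1 (i) p.23] -/
theorem galAlgHom_apply_coe (σ : Bool) (u : ℂˣ) : galAlgHom σ (u : ℂ) = ((galAct σ u : ℂˣ) : ℂ) := by
  cases σ
  · rfl
  · rw [galAlgHom_true, galAct_true, Units.coe_star]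
    rfl

/-- `galAlgHom` turns `xor` into composition (`Gal(ℂ/ℝ) ≅ ℤ/2ℤ`). [cite: MochizukiFrdII2008, Def 3.1 (i) p.23] -/
theorem galAlgHom_xor (σ τ : Bool) : galAlgHom (xor σ τ) = (galAlgHom σ).comp (galAlgHom τ) := by
  apply AlgHom.ext
  intro z
  cases σ <;> cases τ <;> simp [galAlgHom]

/-- The comparison functor on arrows (Spec-direction arrow ↦ the `ℝ`-algebra map in the opposite
direction). [cite: MochizukiFrdII2008, §3 p.23] -/
def toArchBaseMap : {L K : D0} → (L ⟶ K) → (toArchBaseObj L ⟶ toArchBaseObj K)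
  | _, _, .idReal => 𝟙 specReal
  | _, _, .toReal => ⟨Algebra.ofId ℝ ℂ⟩
  | _, _, .gal σ => ⟨galAlgHom σ⟩

/-- **The comparison functor** `D₀^skel ⥤ D₀ = FinEtale ℝ` (RULING W2-3 (2)): `real ↦ Spec ℝ`,
`complex ↦ Spec ℂ`, `gal σ ↦ conj^σ`, `toRealHom ↦ (ℝ ↪ ℂ)`; functoriality PROVED.
[cite: MochizukiFrdII2008, §3 p.23] -/
def toArchBase : D0 ⥤ ArchBase where
  obj := toArchBaseObj
  map := toArchBaseMap
  map_id K := by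
    cases K
    · rfl
    · rfl
  map_comp f g := by
    cases g with
    | idReal => cases f <;> rfl
    | toReal =>
      cases f with
      | gal σ =>
        apply FinEtale.hom_ext
        apply AlgHom.ext
        intro z
        change Algebra.ofId ℝ ℂ z = galAlgHom σ (Algebra.ofId ℝ ℂ z)
        rw [Algebra.ofId_apply, AlgHom.commutes]
    | gal τ =>
      cases f with
      | gal σ =>
        apply FinEtale.hom_ext
        change galAlgHom (xor σ τ) = (galAlgHom σ).comp (galAlgHom τ)
        exact galAlgHom_xor σ τ

/-- `toArchBase real = Spec ℝ`. [cite: MochizukiFrdII2008, §3 p.23] -/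
@[simp] theorem toArchBase_obj_real : toArchBase.obj real = specReal := rfl

/-- `toArchBase complex = Spec ℂ`. [cite: MochizukiFrdII2008, §3 p.23] -/
@[simp] theorem toArchBase_obj_complex : toArchBase.obj complex = specComplex := rfl

/-- `Spec ℝ` is a real object of `ArchBase` (`[ℝ : ℝ] = 1`). [cite: MochizukiFrdII2008, Def 3.1 (v) p.24] -/
theorem isReal_specReal : ArchBase.IsReal specReal := Module.finrank_self ℝ

/-- `Spec ℂ` is a complex object of `ArchBase` (`[ℂ : ℝ] = 2`). [cite: MochizukiFrdII2008, Def 3.1 (v) p.24] -/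
theorem isComplex_specComplex : ArchBase.IsComplex specComplex := Complex.finrank_real_complex

/-- Compatibility of the real predicates: `toArchBase K` is real iff `K` is the real object of the
skeleton. [cite: MochizukiFrdII2008, Def 3.1 (v) p.24] -/
theorem isReal_toArchBase_iff (K : D0) : ArchBase.IsReal (toArchBase.obj K) ↔ K.IsReal := by
  cases K
  · exact ⟨fun _ => rfl, fun _ => isReal_specReal⟩
  · refine ⟨fun h => ?_, fun h => absurd h (by decide)⟩
    have h2 : Module.finrank ℝ ℂ = 2 := Complex.finrank_real_complex
    exact absurd (h.symm.trans h2) (by decide)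

/-- Compatibility of the complex predicates. [cite: MochizukiFrdII2008, Def 3.1 (v) p.24] -/
theorem isComplex_toArchBase_iff (K : D0) : ArchBase.IsComplex (toArchBase.obj K) ↔ K.IsComplex := by
  cases K
  · refine ⟨fun h => ?_, fun h => absurd h (by decide)⟩
    have h1 : Module.finrank ℝ ℝ = 1 := Module.finrank_self ℝ
    exact absurd (h.symm.trans h1) (by decide)
  · exact ⟨fun _ => rfl, fun _ => isComplex_specComplex⟩

/-- For a category over the skeleton, `π : D ⥤ D₀^skel`, t4's `RC.realObjects` of the composite
`π ⋙ toArchBase` are the objects over `real`. [cite: MochizukiFrdII2008, Def 3.1 (v) p.24] -/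
theorem realObjects_comp_iff {D : Type*} [Category D] (π : D ⥤ D0) (A : D) :
    RC.realObjects (π ⋙ toArchBase) A ↔ (π.obj A).IsReal :=
  isReal_toArchBase_iff (π.obj A)

/-- … and `RC.complexObjects` of the composite are the objects over `complex`.
[cite: MochizukiFrdII2008, Def 3.1 (v) p.24] -/
theorem complexObjects_comp_iff {D : Type*} [Category D] (π : D ⥤ D0) (A : D) :
    RC.complexObjects (π ⋙ toArchBase) A ↔ (π.obj A).IsComplex :=
  isComplex_toArchBase_iff (π.obj A)

/-- The comparison functor is faithful (distinct Galois twists give distinct algebra maps: `conj ≠ id`).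
[cite: MochizukiFrdII2008, §3 p.23] -/
theorem toArchBase_faithful : toArchBase.Faithful := by
  refine ⟨fun {L K} f g h => ?_⟩
  cases f with
  | idReal => exact Subsingleton.elim _ _
  | toReal => exact Subsingleton.elim _ _
  | gal σ =>
    cases g with
    | gal τ =>
      have e : galAlgHom σ = galAlgHom τ := congrArg FinEtale.Hom.alg h
      cases σ <;> cases τ
      · rfl
      · exact absurd (congrArg (fun φ : ℂ →ₐ[ℝ] ℂ => (φ Complex.I).im) e) (by norm_num [galAlgHom])
      · exact absurd (congrArg (fun φ : ℂ →ₐ[ℝ] ℂ => (φ Complex.I).im) e) (by norm_num [galAlgHom])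
      · rfl

/-- `toArchBase` maps the nontrivial automorphism `conj` of the skeleton to a NON-identity arrow of
`ArchBase` (used with t4's `RC.IsComplexifiable`, which asks for `P.map β ≠ 𝟙`).
[cite: MochizukiFrdII2008, Def 3.1 (v) p.25] -/
theorem toArchBase_map_conj_ne_id : toArchBase.map conj ≠ 𝟙 (toArchBase.obj complex) := by
  intro h
  haveI := toArchBase_faithful
  exact conj_ne_id (toArchBase.map_injective (h.trans (toArchBase.map_id complex).symm))

/-- Named statement: the comparison functor is an equivalence of categories (every finite extension of
`ℝ` is `ℝ` or `ℂ`; the only `ℝ`-algebra endomorphisms of `ℂ` are `id` and `conj`) — so that the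
skeleton `ArchFrd.D0` IS `D₀` up to equivalence. Not proved here (pool item).
[cite: MochizukiFrdII2008, §3 p.23] -/
def ToArchBaseIsEquivalence : Prop := toArchBase.IsEquivalence

end D0

end ArchFrd

end

end Literature.AlgebraicGeometry.Frobenioids
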